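import Summits.NavierStokesRegularity.OSWSelfSimilar.SheetRLiftEvenOfRecord
import Summits.NavierStokesRegularity.OSWSelfSimilar.SheetRFrameCentreResidual
import HarnessLib

/-!
# SHEET-ℝ frame, EVEN half: THE EVEN LIFT OF RECORD `h⁺` IS `C^∞` WITH THE FOUR WEIGHTED DECAYS — the function-level input of the
# domain binder `h⁺ ∈ D(T⁺*)` of the (P10)⁺ even stability word (HYPOTHESIS-LEDGER v2.4 row (P10)⁺, record half)

HONEST FRAMING (cell ns-blowup GROUP B / zone Z3, case Z3-SR-SPEC EVEN half; 1-D MODEL certificate frame (viscous gCLM/OSW sheet on the line, frame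
`L = 8`); not Euler/NS; «violates: none — MODEL»).  Nothing here asserts that a profile exists; no interval sentence is proved; no number of record
moves.  cert-1 g10's `SheetRGeneratorEvenSmoothDomain.realE_mem_domain_generatorEven_of_smooth` puts the `L²_w` class of an even zero-mass `C²`
profile `φ` in the domain of Kato's closed operator `T⁺ = generatorEven` for EVERY (S1⁺) datum, given the four weights
`∫w φ² , ∫w φ′², ∫w (ξφ′)², ∫w φ″² < ∞` (`w = L² + ξ²`).  For THE even lift of record `h⁺ = liftFunE = Σ_{i<12} h_{i+1}·e⁺_{i+1}`,
`e_n⁺(ξ) = (1 + cos θ)cos nθ`, `θ = 2arctan(ξ/8)` (cert-5 g10 `SheetRLiftEvenOfRecord`, p557948: `liftFunE_neg`, `integrable_liftFunE_and_integral`,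
`integrable_weight_liftFunE_sq` = the parity, zero-mass and `hw0` inputs) these are THEOREMS of elementary calculus, typed here:

* §1 the even frame's first two `ξ`-derivatives in CLOSED RATIONAL FORM (even twin of `SheetRBackboneFrame.hasDerivAt_frame` / `hasDerivAt_frame_deriv`):
  `e_n⁺′ = (−4L²ξ·cos nθ − 4nL³·sin nθ)/(L² + ξ²)²`, `e_n⁺″ = ((−4L²(L² + ξ²) − 8n²L⁴ + 16L²ξ²)·cos nθ + 24nL³ξ·sin nθ)/(L² + ξ²)³`, and the decays
  `|e_n⁺′| ≤ (4n + 2)L/(L² + ξ²)`, `|ξ·e_n⁺′| ≤ (2n + 4)L²/(L² + ξ²)`, `|e_n⁺″| ≤ (20 + 12n + 8n²)/(L² + ξ²)` (twins of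
  `SheetRFrameCentreResidual.abs_mul_frameDeriv_le` / `abs_frameDeriv2_le`, same constants);
* §2 the lift: `contDiff_liftFunE : ContDiff ℝ k liftFunE` (every `k`), `hasDerivAt_liftFunE`, `deriv_liftFunE`, `hasDerivAt_deriv_liftFunE`,
  `deriv_deriv_liftFunE` (finite sums of §1), the bounds `abs_deriv_liftFunE_le`, `abs_mul_deriv_liftFunE_le`, `abs_deriv_deriv_liftFunE_le`
  (each `≤ C/(8² + ξ²)`, `C` explicit in `Σ|h_n|`), and **the weights in the binder shapes of `realE_mem_domain_generatorEven_of_smooth` at `L = 8`,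
  `φ = liftFunE`**: `integrable_weight_deriv_liftFunE_sq` (hw1), `integrable_weight_mul_deriv_liftFunE_sq` (hw1′), `integrable_weight_deriv_deriv_liftFunE_sq`
  (hw2), via `SheetRFrameCentre.integrable_weight_sq_of_le`.
Pure calculus about an explicit function; no definition, no named fact, no instance, no notation.  WHAT THIS IS NOT: not NS; not the domain statement
itself (that is the composition with cert-1's file, typed where the (P10)⁺ word of record is instantiated); nothing about the quality of the lift.
-/

noncomputable section

namespace Summit.NavierStokesRegularity.OSWSelfSimilar
namespace SheetRLiftEvenOfRecordSmooth

open _root_.MeasureTheory _root_.Set _root_.Filter _root_.Real SheetRCayleySubstitution SheetRBackboneFrame SheetRFrameCentreResidual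
  SheetRLiftEvenOfRecord
open scoped Topology

/-! ### §1 The even frame functions `e_n⁺ = (1 + cos θ)cos nθ`: closed-form derivatives and their decay -/

/-- **First derivative of the even frame function**: `e_n⁺′(ξ) = (−4L²ξ·cos nθ − 4nL³·sin nθ)/(L² + ξ²)²` (`θ = 2arctan(ξ/L)`, `L ≠ 0`). [folklore] -/
theorem hasDerivAt_coframe {L : ℝ} (hL : L ≠ 0) (n : ℕ) (ξ : ℝ) :
    HasDerivAt (fun ξ : ℝ => (1 + cos (2 * arctan (ξ / L))) * cos (n * (2 * arctan (ξ / L))))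
      ((-(4 * L ^ 2 * ξ) * cos (n * (2 * arctan (ξ / L))) - 4 * n * L ^ 3 * sin (n * (2 * arctan (ξ / L)))) /
        (L ^ 2 + ξ ^ 2) ^ 2) ξ := by
  have h1 : HasDerivAt (fun ξ : ℝ => 1 + cos (2 * arctan (ξ / L)))
      (-sin (2 * arctan (ξ / L)) * (2 * L / (L ^ 2 + ξ ^ 2))) ξ :=
    ((hasDerivAt_cayleyAngle hL ξ).cos).const_add 1
  have h := h1.mul (hasDerivAt_cos_mul_cayleyAngle hL (n : ℝ) ξ)
  refine h.congr_deriv ?_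
  rw [sin_cayleyAngle hL, one_add_cos_cayleyAngle hL]
  have : L ^ 2 + ξ ^ 2 ≠ 0 := by positivity
  field_simp
  ring

/-- The derivative of `e_n⁺` as a function. [folklore] -/
theorem deriv_coframe {L : ℝ} (hL : L ≠ 0) (n : ℕ) :
    deriv (fun ξ : ℝ => (1 + cos (2 * arctan (ξ / L))) * cos (n * (2 * arctan (ξ / L)))) =
      fun ξ => (-(4 * L ^ 2 * ξ) * cos (n * (2 * arctan (ξ / L))) - 4 * n * L ^ 3 * sin (n * (2 * arctan (ξ / L)))) /
        (L ^ 2 + ξ ^ 2) ^ 2 :=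
  funext fun ξ => (hasDerivAt_coframe hL n ξ).deriv

/-- **Second derivative of the even frame function**: the derivative of `e_n⁺′` in closed form,
`e_n⁺″(ξ) = ((−4L²(L² + ξ²) − 8n²L⁴ + 16L²ξ²)·cos nθ + 24nL³ξ·sin nθ)/(L² + ξ²)³`. [folklore] -/
theorem hasDerivAt_coframe_deriv {L : ℝ} (hL : L ≠ 0) (n : ℕ) (ξ : ℝ) :
    HasDerivAt (fun ξ : ℝ => (-(4 * L ^ 2 * ξ) * cos (n * (2 * arctan (ξ / L))) -
        4 * n * L ^ 3 * sin (n * (2 * arctan (ξ / L)))) / (L ^ 2 + ξ ^ 2) ^ 2)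
      (((-(4 * L ^ 2 * (L ^ 2 + ξ ^ 2)) - 8 * n ^ 2 * L ^ 4 + 16 * L ^ 2 * ξ ^ 2) * cos (n * (2 * arctan (ξ / L)))
        + 24 * n * L ^ 3 * ξ * sin (n * (2 * arctan (ξ / L)))) / (L ^ 2 + ξ ^ 2) ^ 3) ξ := by
  have hw : L ^ 2 + ξ ^ 2 ≠ 0 := by positivity
  have hS := hasDerivAt_sin_mul_cayleyAngle hL (n : ℝ) ξ
  have hC := hasDerivAt_cos_mul_cayleyAngle hL (n : ℝ) ξ
  have hN : HasDerivAt (fun ξ : ℝ => -(4 * L ^ 2 * ξ) * cos (n * (2 * arctan (ξ / L))) -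
      4 * n * L ^ 3 * sin (n * (2 * arctan (ξ / L))))
      (-(4 * L ^ 2 * 1) * cos (n * (2 * arctan (ξ / L))) +
        -(4 * L ^ 2 * ξ) * -(2 * n * L * sin (n * (2 * arctan (ξ / L))) / (L ^ 2 + ξ ^ 2)) -
        4 * n * L ^ 3 * (2 * n * L * cos (n * (2 * arctan (ξ / L))) / (L ^ 2 + ξ ^ 2))) ξ :=
    ((((hasDerivAt_id' ξ).const_mul (4 * L ^ 2)).neg.mul hC).sub (hS.const_mul (4 * n * L ^ 3)))
  have hD : HasDerivAt (fun ξ : ℝ => (L ^ 2 + ξ ^ 2) ^ 2) (2 * (L ^ 2 + ξ ^ 2) ^ 1 * (2 * ξ)) ξ := by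
    have h := ((hasDerivAt_pow 2 ξ).const_add (L ^ 2)).fun_pow 2
    refine h.congr_deriv ?_
    push_cast
    ring
  have h := hN.div hD (pow_ne_zero 2 hw)
  refine h.congr_deriv ?_
  field_simp
  ring

/-- `|e_n⁺′(ξ)| ≤ (4n + 2)L/(L² + ξ²)` (`L > 0`). [folklore] -/
theorem abs_coframeDeriv_le {L : ℝ} (hL : 0 < L) (n : ℕ) (ξ : ℝ) :
    |(-(4 * L ^ 2 * ξ) * cos (n * (2 * arctan (ξ / L))) - 4 * n * L ^ 3 * sin (n * (2 * arctan (ξ / L)))) /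
        (L ^ 2 + ξ ^ 2) ^ 2| ≤ (4 * n + 2) * L / (L ^ 2 + ξ ^ 2) := by
  have hw : 0 < L ^ 2 + ξ ^ 2 := by positivity
  have e : (-(4 * L ^ 2 * ξ) * cos (n * (2 * arctan (ξ / L))) - 4 * n * L ^ 3 * sin (n * (2 * arctan (ξ / L)))) =
      (-(4 * n * L ^ 3)) * sin (n * (2 * arctan (ξ / L))) + (-(4 * L ^ 2 * ξ)) * cos (n * (2 * arctan (ξ / L))) := by ring
  rw [e, abs_div, abs_of_pos (by positivity : (0:ℝ) < (L ^ 2 + ξ ^ 2) ^ 2), div_le_div_iff₀ (by positivity) hw]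
  have h1 := abs_sin_cos_comb_le (-(4 * n * L ^ 3)) (-(4 * L ^ 2 * ξ)) (n * (2 * arctan (ξ / L))) (n * (2 * arctan (ξ / L)))
  have hn : (0 : ℝ) ≤ n := n.cast_nonneg
  have h2 : |-(4 * n * L ^ 3)| = 4 * n * L ^ 3 := by rw [abs_neg, abs_of_nonneg (by positivity)]
  have h3 : |-(4 * L ^ 2 * ξ)| = 4 * L ^ 2 * |ξ| := by rw [abs_neg, abs_mul, abs_of_nonneg (by positivity)]
  have hξ : 2 * L * |ξ| ≤ L ^ 2 + ξ ^ 2 := by nlinarith [sq_nonneg (L - |ξ|), sq_abs ξ]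
  have hL2 : L ^ 2 ≤ L ^ 2 + ξ ^ 2 := by nlinarith [sq_nonneg ξ]
  have hA : 4 * n * L ^ 3 ≤ 4 * n * L * (L ^ 2 + ξ ^ 2) := by
    calc 4 * n * L ^ 3 = 4 * n * L * L ^ 2 := by ring
      _ ≤ 4 * n * L * (L ^ 2 + ξ ^ 2) := mul_le_mul_of_nonneg_left hL2 (by positivity)
  have hB : 4 * L ^ 2 * |ξ| ≤ 2 * L * (L ^ 2 + ξ ^ 2) := by
    calc 4 * L ^ 2 * |ξ| = 2 * L * (2 * L * |ξ|) := by ring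
      _ ≤ 2 * L * (L ^ 2 + ξ ^ 2) := mul_le_mul_of_nonneg_left hξ (by positivity)
  calc |(-(4 * n * L ^ 3)) * sin (n * (2 * arctan (ξ / L))) + (-(4 * L ^ 2 * ξ)) * cos (n * (2 * arctan (ξ / L)))| * (L ^ 2 + ξ ^ 2)
      ≤ (|-(4 * n * L ^ 3)| + |-(4 * L ^ 2 * ξ)|) * (L ^ 2 + ξ ^ 2) := mul_le_mul_of_nonneg_right h1 hw.le
    _ = (4 * n * L ^ 3 + 4 * L ^ 2 * |ξ|) * (L ^ 2 + ξ ^ 2) := by rw [h2, h3]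
    _ ≤ (4 * n * L * (L ^ 2 + ξ ^ 2) + 2 * L * (L ^ 2 + ξ ^ 2)) * (L ^ 2 + ξ ^ 2) :=
        mul_le_mul_of_nonneg_right (add_le_add hA hB) hw.le
    _ = (4 * n + 2) * L * (L ^ 2 + ξ ^ 2) ^ 2 := by ring

/-- `|ξ·e_n⁺′(ξ)| ≤ (2n + 4)L²/(L² + ξ²)` (`L > 0`). [folklore] -/
theorem abs_mul_coframeDeriv_le {L : ℝ} (hL : 0 < L) (n : ℕ) (ξ : ℝ) :
    |ξ * ((-(4 * L ^ 2 * ξ) * cos (n * (2 * arctan (ξ / L))) - 4 * n * L ^ 3 * sin (n * (2 * arctan (ξ / L)))) /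
        (L ^ 2 + ξ ^ 2) ^ 2)| ≤ (2 * n + 4) * L ^ 2 / (L ^ 2 + ξ ^ 2) := by
  have hw : 0 < L ^ 2 + ξ ^ 2 := by positivity
  have e : ξ * ((-(4 * L ^ 2 * ξ) * cos (n * (2 * arctan (ξ / L))) - 4 * n * L ^ 3 * sin (n * (2 * arctan (ξ / L)))) /
        (L ^ 2 + ξ ^ 2) ^ 2) =
      ((-(4 * n * L ^ 3 * ξ)) * sin (n * (2 * arctan (ξ / L))) + (-(4 * L ^ 2 * ξ ^ 2)) * cos (n * (2 * arctan (ξ / L))))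
        / (L ^ 2 + ξ ^ 2) ^ 2 := by ring
  rw [e, abs_div, abs_of_pos (by positivity : (0:ℝ) < (L ^ 2 + ξ ^ 2) ^ 2), div_le_div_iff₀ (by positivity) hw]
  have h1 := abs_sin_cos_comb_le (-(4 * n * L ^ 3 * ξ)) (-(4 * L ^ 2 * ξ ^ 2)) (n * (2 * arctan (ξ / L))) (n * (2 * arctan (ξ / L)))
  have hn : (0 : ℝ) ≤ n := n.cast_nonneg
  have h2 : |-(4 * n * L ^ 3 * ξ)| = 4 * n * L ^ 3 * |ξ| := by rw [abs_neg, abs_mul, abs_of_nonneg (by positivity)]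
  have h3 : |-(4 * L ^ 2 * ξ ^ 2)| = 4 * L ^ 2 * ξ ^ 2 := by rw [abs_neg, abs_of_nonneg (by positivity)]
  have hξ : 2 * L * |ξ| ≤ L ^ 2 + ξ ^ 2 := by nlinarith [sq_nonneg (L - |ξ|), sq_abs ξ]
  have hA : 4 * n * L ^ 3 * |ξ| ≤ 2 * n * L ^ 2 * (L ^ 2 + ξ ^ 2) := by
    calc 4 * n * L ^ 3 * |ξ| = 2 * n * L ^ 2 * (2 * L * |ξ|) := by ring
      _ ≤ 2 * n * L ^ 2 * (L ^ 2 + ξ ^ 2) := mul_le_mul_of_nonneg_left hξ (by positivity)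
  have hB : 4 * L ^ 2 * ξ ^ 2 ≤ 4 * L ^ 2 * (L ^ 2 + ξ ^ 2) := by nlinarith [mul_nonneg (sq_nonneg L) (sq_nonneg L)]
  calc |(-(4 * n * L ^ 3 * ξ)) * sin (n * (2 * arctan (ξ / L))) + (-(4 * L ^ 2 * ξ ^ 2)) * cos (n * (2 * arctan (ξ / L)))|
        * (L ^ 2 + ξ ^ 2)
      ≤ (|-(4 * n * L ^ 3 * ξ)| + |-(4 * L ^ 2 * ξ ^ 2)|) * (L ^ 2 + ξ ^ 2) := mul_le_mul_of_nonneg_right h1 hw.le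
    _ = (4 * n * L ^ 3 * |ξ| + 4 * L ^ 2 * ξ ^ 2) * (L ^ 2 + ξ ^ 2) := by rw [h2, h3]
    _ ≤ (2 * n * L ^ 2 * (L ^ 2 + ξ ^ 2) + 4 * L ^ 2 * (L ^ 2 + ξ ^ 2)) * (L ^ 2 + ξ ^ 2) :=
        mul_le_mul_of_nonneg_right (add_le_add hA hB) hw.le
    _ = (2 * n + 4) * L ^ 2 * (L ^ 2 + ξ ^ 2) ^ 2 := by ring

/-- `|e_n⁺″(ξ)| ≤ (20 + 12n + 8n²)/(L² + ξ²)` (`L > 0`). [folklore] -/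
theorem abs_coframeDeriv2_le {L : ℝ} (hL : 0 < L) (n : ℕ) (ξ : ℝ) :
    |((-(4 * L ^ 2 * (L ^ 2 + ξ ^ 2)) - 8 * n ^ 2 * L ^ 4 + 16 * L ^ 2 * ξ ^ 2) * cos (n * (2 * arctan (ξ / L)))
        + 24 * n * L ^ 3 * ξ * sin (n * (2 * arctan (ξ / L)))) / (L ^ 2 + ξ ^ 2) ^ 3|
      ≤ (20 + 12 * n + 8 * n ^ 2) / (L ^ 2 + ξ ^ 2) := by
  have hw : 0 < L ^ 2 + ξ ^ 2 := by positivity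
  have e : ((-(4 * L ^ 2 * (L ^ 2 + ξ ^ 2)) - 8 * n ^ 2 * L ^ 4 + 16 * L ^ 2 * ξ ^ 2) * cos (n * (2 * arctan (ξ / L)))
        + 24 * n * L ^ 3 * ξ * sin (n * (2 * arctan (ξ / L)))) =
      (24 * n * L ^ 3 * ξ) * sin (n * (2 * arctan (ξ / L)))
        + ((-(4 * L ^ 2 * (L ^ 2 + ξ ^ 2)) - 8 * n ^ 2 * L ^ 4 + 16 * L ^ 2 * ξ ^ 2)) * cos (n * (2 * arctan (ξ / L))) := by
    ring
  rw [e, abs_div, abs_of_pos (by positivity : (0:ℝ) < (L ^ 2 + ξ ^ 2) ^ 3), div_le_div_iff₀ (by positivity) hw]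
  have h1 := abs_sin_cos_comb_le (24 * n * L ^ 3 * ξ) ((-(4 * L ^ 2 * (L ^ 2 + ξ ^ 2)) - 8 * n ^ 2 * L ^ 4 + 16 * L ^ 2 * ξ ^ 2))
    (n * (2 * arctan (ξ / L))) (n * (2 * arctan (ξ / L)))
  have hn : (0 : ℝ) ≤ n := n.cast_nonneg
  have hξ : 2 * L * |ξ| ≤ L ^ 2 + ξ ^ 2 := by nlinarith [sq_nonneg (L - |ξ|), sq_abs ξ]
  have h2 : |24 * n * L ^ 3 * ξ| ≤ 12 * n * L ^ 2 * (L ^ 2 + ξ ^ 2) := by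
    rw [abs_mul, abs_of_nonneg (by positivity : (0:ℝ) ≤ 24 * n * L ^ 3)]
    calc 24 * n * L ^ 3 * |ξ| = 12 * n * L ^ 2 * (2 * L * |ξ|) := by ring
      _ ≤ 12 * n * L ^ 2 * (L ^ 2 + ξ ^ 2) := mul_le_mul_of_nonneg_left hξ (by positivity)
  have h3 : |(-(4 * L ^ 2 * (L ^ 2 + ξ ^ 2)) - 8 * n ^ 2 * L ^ 4 + 16 * L ^ 2 * ξ ^ 2)| ≤ (20 + 8 * n ^ 2) * L ^ 2 * (L ^ 2 + ξ ^ 2) := by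
    rw [abs_le]; constructor <;>
      nlinarith [sq_nonneg L, sq_nonneg ξ, mul_nonneg (sq_nonneg L) (sq_nonneg ξ), mul_nonneg (sq_nonneg L) (sq_nonneg L),
        mul_nonneg (mul_nonneg hn hn) (mul_nonneg (sq_nonneg L) (sq_nonneg ξ)),
        mul_nonneg (mul_nonneg hn hn) (mul_nonneg (sq_nonneg L) (sq_nonneg L))]
  have hL2 : L ^ 2 ≤ L ^ 2 + ξ ^ 2 := by nlinarith [sq_nonneg ξ]
  calc |(24 * n * L ^ 3 * ξ) * sin (n * (2 * arctan (ξ / L)))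
        + ((-(4 * L ^ 2 * (L ^ 2 + ξ ^ 2)) - 8 * n ^ 2 * L ^ 4 + 16 * L ^ 2 * ξ ^ 2)) * cos (n * (2 * arctan (ξ / L)))|
        * (L ^ 2 + ξ ^ 2)
      ≤ (|24 * n * L ^ 3 * ξ| + |(-(4 * L ^ 2 * (L ^ 2 + ξ ^ 2)) - 8 * n ^ 2 * L ^ 4 + 16 * L ^ 2 * ξ ^ 2)|)
          * (L ^ 2 + ξ ^ 2) := mul_le_mul_of_nonneg_right h1 hw.le
    _ ≤ (12 * n * L ^ 2 * (L ^ 2 + ξ ^ 2) + (20 + 8 * n ^ 2) * L ^ 2 * (L ^ 2 + ξ ^ 2)) * (L ^ 2 + ξ ^ 2) :=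
        mul_le_mul_of_nonneg_right (add_le_add h2 h3) hw.le
    _ = (20 + 12 * n + 8 * n ^ 2) * (L ^ 2 * (L ^ 2 + ξ ^ 2) ^ 2) := by ring
    _ ≤ (20 + 12 * n + 8 * n ^ 2) * ((L ^ 2 + ξ ^ 2) * (L ^ 2 + ξ ^ 2) ^ 2) := by
        have hk : (0:ℝ) ≤ 20 + 12 * n + 8 * n ^ 2 := by positivity
        exact mul_le_mul_of_nonneg_left (mul_le_mul_of_nonneg_right hL2 (by positivity)) hk
    _ = (20 + 12 * n + 8 * n ^ 2) * (L ^ 2 + ξ ^ 2) ^ 3 := by ring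

/-! ### §2 The even lift of record `h⁺ = liftFunE`: smoothness, closed-form derivatives, decay, and the four weights -/

/-- **`h⁺` is `C^k` for every `k`** (a finite combination of the smooth companion functions). [folklore] -/
theorem contDiff_liftFunE {k : WithTop ℕ∞} : ContDiff ℝ k liftFunE :=
  ContDiff.sum fun i _ => contDiff_const.mul (contDiff_coframe 8 (i + 1))

/-- The derivative of `h⁺` at `ξ` is `Σ_{i<12} h_{i+1}·e⁺_{i+1}′(ξ)` (closed form of §1, `L = 8`). [folklore] -/
theorem hasDerivAt_liftFunE (ξ : ℝ) :
    HasDerivAt liftFunE (∑ i ∈ Finset.range 12, liftCoeffE i *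
      ((-(4 * (8:ℝ) ^ 2 * ξ) * cos ((i + 1 : ℕ) * (2 * arctan (ξ / 8))) - 4 * (i + 1 : ℕ) * (8:ℝ) ^ 3 * sin ((i + 1 : ℕ) * (2 * arctan (ξ / 8)))) /
        ((8:ℝ) ^ 2 + ξ ^ 2) ^ 2)) ξ :=
  HasDerivAt.fun_sum fun i _ => (hasDerivAt_coframe (by norm_num : (8:ℝ) ≠ 0) (i + 1) ξ).const_mul (liftCoeffE i)

/-- `h⁺′` in closed form. [folklore] -/
theorem deriv_liftFunE : deriv liftFunE = fun ξ => ∑ i ∈ Finset.range 12, liftCoeffE i *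
      ((-(4 * (8:ℝ) ^ 2 * ξ) * cos ((i + 1 : ℕ) * (2 * arctan (ξ / 8))) - 4 * (i + 1 : ℕ) * (8:ℝ) ^ 3 * sin ((i + 1 : ℕ) * (2 * arctan (ξ / 8)))) /
        ((8:ℝ) ^ 2 + ξ ^ 2) ^ 2) :=
  funext fun ξ => (hasDerivAt_liftFunE ξ).deriv

/-- The derivative of `h⁺′` at `ξ` is `Σ_{i<12} h_{i+1}·e⁺_{i+1}″(ξ)` (closed form of §1, `L = 8`). [folklore] -/
theorem hasDerivAt_deriv_liftFunE (ξ : ℝ) :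
    HasDerivAt (deriv liftFunE) (∑ i ∈ Finset.range 12, liftCoeffE i *
      (((-(4 * (8:ℝ) ^ 2 * ((8:ℝ) ^ 2 + ξ ^ 2)) - 8 * (i + 1 : ℕ) ^ 2 * (8:ℝ) ^ 4 + 16 * (8:ℝ) ^ 2 * ξ ^ 2) *
          cos ((i + 1 : ℕ) * (2 * arctan (ξ / 8)))
        + 24 * (i + 1 : ℕ) * (8:ℝ) ^ 3 * ξ * sin ((i + 1 : ℕ) * (2 * arctan (ξ / 8)))) / ((8:ℝ) ^ 2 + ξ ^ 2) ^ 3)) ξ := by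
  rw [deriv_liftFunE]
  exact HasDerivAt.fun_sum fun i _ => (hasDerivAt_coframe_deriv (by norm_num : (8:ℝ) ≠ 0) (i + 1) ξ).const_mul (liftCoeffE i)

/-- `h⁺″` in closed form. [folklore] -/
theorem deriv_deriv_liftFunE : deriv (deriv liftFunE) = fun ξ => ∑ i ∈ Finset.range 12, liftCoeffE i *
      (((-(4 * (8:ℝ) ^ 2 * ((8:ℝ) ^ 2 + ξ ^ 2)) - 8 * (i + 1 : ℕ) ^ 2 * (8:ℝ) ^ 4 + 16 * (8:ℝ) ^ 2 * ξ ^ 2) *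
          cos ((i + 1 : ℕ) * (2 * arctan (ξ / 8)))
        + 24 * (i + 1 : ℕ) * (8:ℝ) ^ 3 * ξ * sin ((i + 1 : ℕ) * (2 * arctan (ξ / 8)))) / ((8:ℝ) ^ 2 + ξ ^ 2) ^ 3) :=
  funext fun ξ => (hasDerivAt_deriv_liftFunE ξ).deriv

/-- `h⁺′` is continuous. [folklore] -/
theorem continuous_deriv_liftFunE : Continuous (deriv liftFunE) :=
  (contDiff_liftFunE (k := 1)).continuous_deriv le_rfl

/-- `h⁺″` is continuous. [folklore] -/
theorem continuous_deriv_deriv_liftFunE : Continuous (deriv (deriv liftFunE)) := by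
  have h : ContDiff ℝ 2 liftFunE := contDiff_liftFunE
  have h2 := h.continuous_iteratedDeriv 2 le_rfl
  rwa [iteratedDeriv_succ, iteratedDeriv_one] at h2

/-- **`|h⁺′(ξ)| ≤ (8·Σ_{i<12}(4i + 6)|h_{i+1}|)/(8² + ξ²)`.** [folklore] -/
theorem abs_deriv_liftFunE_le (ξ : ℝ) :
    |deriv liftFunE ξ| ≤ (∑ i ∈ Finset.range 12, (4 * ((i + 1 : ℕ) : ℝ) + 2) * 8 * |liftCoeffE i|) / ((8:ℝ) ^ 2 + ξ ^ 2) := by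
  rw [deriv_liftFunE]
  simp only
  rw [Finset.sum_div]
  refine (Finset.abs_sum_le_sum_abs _ _).trans (Finset.sum_le_sum fun i _ => ?_)
  rw [abs_mul]
  have h := abs_coframeDeriv_le (by norm_num : (0:ℝ) < 8) (i + 1) ξ
  calc |liftCoeffE i| * |(-(4 * (8:ℝ) ^ 2 * ξ) * cos ((i + 1 : ℕ) * (2 * arctan (ξ / 8))) -
          4 * (i + 1 : ℕ) * (8:ℝ) ^ 3 * sin ((i + 1 : ℕ) * (2 * arctan (ξ / 8)))) / ((8:ℝ) ^ 2 + ξ ^ 2) ^ 2|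
      ≤ |liftCoeffE i| * ((4 * ((i + 1 : ℕ) : ℝ) + 2) * 8 / ((8:ℝ) ^ 2 + ξ ^ 2)) := mul_le_mul_of_nonneg_left h (abs_nonneg _)
    _ = (4 * ((i + 1 : ℕ) : ℝ) + 2) * 8 * |liftCoeffE i| / ((8:ℝ) ^ 2 + ξ ^ 2) := by ring

/-- **`|ξ·h⁺′(ξ)| ≤ (8²·Σ_{i<12}(2i + 6)|h_{i+1}|)/(8² + ξ²)`.** [folklore] -/
theorem abs_mul_deriv_liftFunE_le (ξ : ℝ) :
    |ξ * deriv liftFunE ξ| ≤ (∑ i ∈ Finset.range 12, (2 * ((i + 1 : ℕ) : ℝ) + 4) * (8:ℝ) ^ 2 * |liftCoeffE i|) / ((8:ℝ) ^ 2 + ξ ^ 2) := by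
  rw [deriv_liftFunE]
  simp only
  rw [Finset.mul_sum, Finset.sum_div]
  refine (Finset.abs_sum_le_sum_abs _ _).trans (Finset.sum_le_sum fun i _ => ?_)
  have e : ξ * (liftCoeffE i * ((-(4 * (8:ℝ) ^ 2 * ξ) * cos ((i + 1 : ℕ) * (2 * arctan (ξ / 8))) -
        4 * (i + 1 : ℕ) * (8:ℝ) ^ 3 * sin ((i + 1 : ℕ) * (2 * arctan (ξ / 8)))) / ((8:ℝ) ^ 2 + ξ ^ 2) ^ 2)) =
      liftCoeffE i * (ξ * ((-(4 * (8:ℝ) ^ 2 * ξ) * cos ((i + 1 : ℕ) * (2 * arctan (ξ / 8))) -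
        4 * (i + 1 : ℕ) * (8:ℝ) ^ 3 * sin ((i + 1 : ℕ) * (2 * arctan (ξ / 8)))) / ((8:ℝ) ^ 2 + ξ ^ 2) ^ 2)) := by ring
  rw [e, abs_mul]
  have h := abs_mul_coframeDeriv_le (by norm_num : (0:ℝ) < 8) (i + 1) ξ
  calc |liftCoeffE i| * |ξ * ((-(4 * (8:ℝ) ^ 2 * ξ) * cos ((i + 1 : ℕ) * (2 * arctan (ξ / 8))) -
          4 * (i + 1 : ℕ) * (8:ℝ) ^ 3 * sin ((i + 1 : ℕ) * (2 * arctan (ξ / 8)))) / ((8:ℝ) ^ 2 + ξ ^ 2) ^ 2)|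
      ≤ |liftCoeffE i| * ((2 * ((i + 1 : ℕ) : ℝ) + 4) * (8:ℝ) ^ 2 / ((8:ℝ) ^ 2 + ξ ^ 2)) := mul_le_mul_of_nonneg_left h (abs_nonneg _)
    _ = (2 * ((i + 1 : ℕ) : ℝ) + 4) * (8:ℝ) ^ 2 * |liftCoeffE i| / ((8:ℝ) ^ 2 + ξ ^ 2) := by ring

/-- **`|h⁺″(ξ)| ≤ (Σ_{i<12}(20 + 12(i+1) + 8(i+1)²)|h_{i+1}|)/(8² + ξ²)`.** [folklore] -/
theorem abs_deriv_deriv_liftFunE_le (ξ : ℝ) :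
    |deriv (deriv liftFunE) ξ| ≤
      (∑ i ∈ Finset.range 12, (20 + 12 * ((i + 1 : ℕ) : ℝ) + 8 * ((i + 1 : ℕ) : ℝ) ^ 2) * |liftCoeffE i|) / ((8:ℝ) ^ 2 + ξ ^ 2) := by
  rw [deriv_deriv_liftFunE]
  simp only
  rw [Finset.sum_div]
  refine (Finset.abs_sum_le_sum_abs _ _).trans (Finset.sum_le_sum fun i _ => ?_)
  rw [abs_mul]
  have h := abs_coframeDeriv2_le (by norm_num : (0:ℝ) < 8) (i + 1) ξ
  calc |liftCoeffE i| * |((-(4 * (8:ℝ) ^ 2 * ((8:ℝ) ^ 2 + ξ ^ 2)) - 8 * (i + 1 : ℕ) ^ 2 * (8:ℝ) ^ 4 + 16 * (8:ℝ) ^ 2 * ξ ^ 2) *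
          cos ((i + 1 : ℕ) * (2 * arctan (ξ / 8)))
        + 24 * (i + 1 : ℕ) * (8:ℝ) ^ 3 * ξ * sin ((i + 1 : ℕ) * (2 * arctan (ξ / 8)))) / ((8:ℝ) ^ 2 + ξ ^ 2) ^ 3|
      ≤ |liftCoeffE i| * ((20 + 12 * ((i + 1 : ℕ) : ℝ) + 8 * ((i + 1 : ℕ) : ℝ) ^ 2) / ((8:ℝ) ^ 2 + ξ ^ 2)) :=
        mul_le_mul_of_nonneg_left h (abs_nonneg _)
    _ = (20 + 12 * ((i + 1 : ℕ) : ℝ) + 8 * ((i + 1 : ℕ) : ℝ) ^ 2) * |liftCoeffE i| / ((8:ℝ) ^ 2 + ξ ^ 2) := by ring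

/-- **Weight (hw1): `∫(8² + ξ²)·h⁺′(ξ)² < ∞`.** [folklore] -/
theorem integrable_weight_deriv_liftFunE_sq : Integrable fun y => ((8:ℝ) ^ 2 + y ^ 2) * deriv liftFunE y ^ 2 :=
  SheetRFrameCentre.integrable_weight_sq_of_le (by norm_num : (0:ℝ) < 8) continuous_deriv_liftFunE abs_deriv_liftFunE_le

/-- **Weight (hw1′): `∫(8² + ξ²)·(ξ·h⁺′(ξ))² < ∞`.** [folklore] -/
theorem integrable_weight_mul_deriv_liftFunE_sq : Integrable fun y => ((8:ℝ) ^ 2 + y ^ 2) * (y * deriv liftFunE y) ^ 2 :=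
  SheetRFrameCentre.integrable_weight_sq_of_le (by norm_num : (0:ℝ) < 8) (continuous_id.mul continuous_deriv_liftFunE)
    abs_mul_deriv_liftFunE_le

/-- **Weight (hw2): `∫(8² + ξ²)·h⁺″(ξ)² < ∞`.** [folklore] -/
theorem integrable_weight_deriv_deriv_liftFunE_sq : Integrable fun y => ((8:ℝ) ^ 2 + y ^ 2) * deriv (deriv liftFunE) y ^ 2 :=
  SheetRFrameCentre.integrable_weight_sq_of_le (by norm_num : (0:ℝ) < 8) continuous_deriv_deriv_liftFunE abs_deriv_deriv_liftFunE_le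

/-- **The even lift of record satisfies every function-level hypothesis of `SheetRGeneratorEvenSmoothDomain.realE_mem_domain_generatorEven_of_smooth`
at `L = 8`, `φ = liftFunE`** — packaged as one conjunction in that theorem's binder order (hφ at `k = 2`, heven, hz, hw0, hw1, hw1′, hw2; the class-level
inputs `hgφ`/`hg` are `SheetRLiftEvenOfRecord.liftEOfRecord_ae_and_norm.1` / `liftEOfRecord_mem_WevenZ`). [folklore] -/
theorem liftFunE_smooth_weights :
    ContDiff ℝ 2 liftFunE ∧ (∀ y, liftFunE (-y) = liftFunE y) ∧ (∫ y, liftFunE y = 0) ∧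
      (Integrable fun y => ((8:ℝ) ^ 2 + y ^ 2) * liftFunE y ^ 2) ∧
      (Integrable fun y => ((8:ℝ) ^ 2 + y ^ 2) * deriv liftFunE y ^ 2) ∧
      (Integrable fun y => ((8:ℝ) ^ 2 + y ^ 2) * (y * deriv liftFunE y) ^ 2) ∧
      (Integrable fun y => ((8:ℝ) ^ 2 + y ^ 2) * deriv (deriv liftFunE) y ^ 2) :=
  ⟨contDiff_liftFunE, liftFunE_neg, integrable_liftFunE_and_integral.2, integrable_weight_liftFunE_sq,
    integrable_weight_deriv_liftFunE_sq, integrable_weight_mul_deriv_liftFunE_sq, integrable_weight_deriv_deriv_liftFunE_sq⟩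

end SheetRLiftEvenOfRecordSmooth
end Summit.NavierStokesRegularity.OSWSelfSimilar

end
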